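import Mathlib
import Literature.Computability.Complexity.CNF
import Literature.Computability.MetaComplexity.ResolutionPlays
import Literature.Computability.MetaComplexity.GadgetLift
import HarnessLib

/-!
# IP-lifted universes, block rank, deficiency closure, parity decision DAGs and the closure piece game

Topic `Literature/Computability/MetaComplexity` (proof complexity of `Res(⊕)` = resolution over
parities; lifting with the inner-product gadget).  This file is VOCABULARY ONLY (definitions and two
one-line lemmas): the finite objects over `𝔽₂ = ZMod 2` in which the current dag-like `Res(⊕)`
lower-bound programme is phrased, rendered so that summit-side theses can state conjectures about
them.  Nothing here is a claim.

* `IPBlock h`, `IPOmega n h`: the lifted universe `Ω_{n,h} = (𝔽₂^h × 𝔽₂^h)^{[n]}`, one *block*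
  (`2h` coordinates, `h` pairs) per base variable `z_v`; `ipBit` its Boolean
  value (through the tree's `ipGadget`, `GadgetLift.lean`), `blockAssignment y` / `ipAssignment y` the induced
  assignments of the block variables of `ipLift h φ` and of the base variables `z(y)`
  (Bhattacharya–Chattopadhyay 2025 (BC25), §3.3, Def. 3.5–3.6: blocks and the lift `Φ ∘ g`).
* `blockProj`, `blockRank A S` (`ρ_A(S)`, the codimension of the projection of the affine subspace `A`
  to the blocks `S`), `IsBlockClosed θ A T` / `blockClosure θ A` (the *deficiency closure* at rate `θ`:
  `T` is closed iff every nonempty outside block-set `U` has rank increment `≤ θ|U| − 1`; the closure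
  is the least closed set = the intersection of all closed sets) and `IsGoodLabel θ D A` (`|cl_θ(A)| ≤ D`).
  This is the block-wise variant of the closure of a set of linear forms of Efremenko–Garlík–Itsykson
  2024 (EGI24, §1.3.2 and §4: "inclusion-minimal set of pigeons such that … becomes safe", uniqueness
  Lemma 4.1) and of BC25 Def. 3.18–3.19 (closure of an affine space := closure of the rows of `M`,
  `A = {x | Mx = b}`); the rate-`θ` deficiency form is the one used with gadgets of logarithmic arity.
* `DagNode`, `ParityDag n h N`: a *parity decision DAG* (affine DAG) on `Ω_{n,h}` with `N` nodes —
  one root labelled `⊤`, every node labelled by an affine subspace (possibly `⊥`), *decision* nodes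
  with a linear query `f_u` and two distinct children whose labels contain the two halves
  `A_u ∩ {f_u = b}` and have no other parent, *pass* (weakening) nodes with one child `A_u ≤ A_w`,
  and sinks; acyclic through a ranking.  `Refutes G φ`: every sink label falsifies, through the
  gadget, one fixed clause of the BASE CNF `φ` (BC25 Def. 3.2 "affine DAG for Search(Φ)", with the lift
  folded into the semantics; Alekseev–Itsykson 2025 §2; EGI24 §2).  `badMass` is `β(π) = Σ_{u bad}|A_u|/|Ω|`.
* `IsADFamily φ k H`: an Atserias–Dalmau family of records (sets of true literals of the base
  variables): contains `∅`, closed under sub-records, falsifies no clause of `φ`, extension property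
  below size `k` — exactly the four conclusions of the tree's `adGood_family` (Atserias–Dalmau 2008,
  Def. 2 / Thm. 2), so `adGood_family` produces one whenever every resolution refutation of `φ` has
  width `> k`.  `IsLegalTrapper H δ`: an OBLIVIOUS demand rule `δ(record, J) ∈ {0,1}^{[n]}` that keeps
  the record inside `H` whenever some demand does (`exists_isLegalTrapper`).
* The CLOSURE PIECE GAME of a DAG `G` at rate `θ`, budget `D`, against the demand rule `δ`
  (positions `(u, α)` with `α` a *closure assignment* = the block coordinates on `cl(A_u)`, BC25
  Def. 3.20; the *piece* `Q_{(u,α)} = A_u ∩ {y_{cl(A_u)} = α}` = BC25's `A_y`; the *newly closed blocks*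
  `J_u`; the class demanded by `δ`; moves `y* ∈ Q_{P,δ} ∩ A_c` to a child `c`, continuing at
  `(c, y*|_{cl(A_c)})` if `c` is good and ending at the terminal `(P, c)` if `c` is bad): the types
  `ClosureRecord`, `GamePosition`, `GameVertex` and, in the `ParityDag` namespace (dot notation on the
  DAG `G`), adjacency `Adj`, root paths (`IsRootPath`, lists chained by `Adj`), blocking sets
  (`IsBlocking`: meets every maximal root path), the closure-corrected piece mass `pieceMass`
  (`Φ(u,α) = 2^{|cl(A_u)|}·|Q|`), the *edge coupling* `iota` (`ι(u→c) = codim B − ρ_B(K∪J) − ρ_B(K∪R) + ρ_B(K)`,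
  the conditional mutual information, under the uniform law on the edge label `B`, between the newly
  closed and the still-free blocks given the old closure `K`), its path sums `pathIota`, and the
  min-cut floor predicate `HasCutFloor`.  The game is the structured form of the "random walk on the
  affine DAG steered through closure assignments" of Alekseev–Itsykson 2025 / BC25 §5–6, with the
  adversary's answers supplied by an Atserias–Dalmau family as in dag-like lifting
  (Garg–Göös–Kamath–Sokolov, GargEtAl2020); the weights `Φ`, `ι` are the summit-side programme's and are defined
  here only so that theses can quantify over them.

## Design notes

* Everything is finite linear algebra over `ZMod 2`; cardinalities are `Nat.card` of carriers, so no
  measure theory.  `blockRank`, `iota` are `ℕ`-valued with truncated subtraction whose true value is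
  provably non-negative (`map` into a `2h|S|`-dimensional range; supermodularity of `ρ_B`); users who
  need the integer identity prove the inequality first.  `blockClosure` is defined as the intersection
  of all closed block sets (closed sets are closed under intersection by supermodularity — EGI24 §4.1 —
  so this IS the least closed set; `univ` is closed, so the intersection is over a nonempty family).
* The position DAG is given on the full finite type `GameVertex n h N` (all pairs `(u, α)` and all
  terminals); invalid or unreachable vertices have no edges and do not lie on root paths, so blocking
  sets and cut floors only see the reachable part.  Demand rules are deterministic and a parameter:
  theses quantify over all legal ones (the lexicographic Atserias–Dalmau Trapper is one).
* The Trapper's demand is asked on `J_u :=` (⋃ over GOOD children `c` of `cl(A_c)`) `∖ cl(A_u)` and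
  depends only on `(z(α), J_u)` (obliviousness); `|J_u| ≤ 2D`.
* Deliberately NOT here: the lifted CNF `φ ∘ IP` as a `CNF ℕ` and the conversion between `ParityDag`
  refutations and the tree's sequent-style `IsResLinRefutation` (separate file `LiftIP.lean`); any
  claim about the game (floors, equidistribution, conservation) — those are summit-side items.

## References

* [BhattacharyaChattopadhyay2025] S. Bhattacharya, A. Chattopadhyay, *Exponential lower bounds on the
  size of ResLin proofs of nearly quadratic depth*, arXiv:2507.23008 (2025), §3 (Def. 3.2 affine DAGs,
  Def. 3.5–3.6 lifted CNFs and blocks, Def. 3.14–3.20 safe sets, closure, closure assignments).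
* [EfremenkoGarlikItsykson2024] K. Efremenko, M. Garlík, D. Itsykson, *Lower bounds for regular
  resolution over parities*, STOC 2024, §1.3 and §4 (closure of a set of linear forms; uniqueness,
  size bound, increment).
* [AlekseevItsykson2025] Y. Alekseev, D. Itsykson, *Lifting to bounded-depth and regular resolutions
  over parities via games*, STOC 2025, §2–3.
* [AtseriasDalmau2008] A. Atserias, V. Dalmau, *A combinatorial characterization of resolution width*,
  JCSS 74 (2008), Def. 2, Thm. 2.
* [GargEtAl2020] A. Garg, M. Göös, P. Kamath, D. Sokolov, *Monotone circuit lower bounds from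
  resolution*, Theory Comput. 16 (2020) (dag-like lifting; adversary strategies from width).
-/

namespace Literature.Computability.MetaComplexity

open Complexity Finset

noncomputable section
open scoped Classical

/-! ### The lifted universe and the inner-product gadget -/

/-- One block of the lifted universe: the `2h` coordinates over `𝔽₂` that replace the base variable
`z_v` under the inner-product lift, read as `h` pairs `(2j, 2j+1)` exactly as in `ipGadget h`
(`GadgetLift.lean`). [cite: BhattacharyaChattopadhyay2025, Def. 3.6 (blocks)] -/
abbrev IPBlock (h : ℕ) : Type := Fin (2 * h) → ZMod 2

/-- The lifted universe `Ω_{n,h} := (𝔽₂^{2h})^{[n]}`, an `𝔽₂`-vector space of dimension `2hn`; block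
`v < n` carries the block variables `v·2h, …, v·2h + 2h − 1` of `ipLift h`. [cite: BhattacharyaChattopadhyay2025, Def. 3.5–3.6 (variables x_{i,j} of the lift)] -/
abbrev IPOmega (n h : ℕ) : Type := Fin n → IPBlock h

/-- A block as a Boolean vector (`1 ↦ true`). [folklore] -/
def IPBlock.toBool {h : ℕ} (y : IPBlock h) : Fin (2 * h) → Bool := fun j => decide (y j = 1)

/-- The gadget value `IP_h(y_v) = ⊕_{j<h} (y_{2j} ∧ y_{2j+1})` of a block, through the tree's
`ipGadget`. [cite: BhattacharyaChattopadhyay2025, Thm. 1.1 (inner product gadget)] -/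
def ipBit {h : ℕ} (y : IPBlock h) : Bool := ipGadget h y.toBool

/-- The assignment `σ_y` of the BLOCK variables of `ipLift h` induced by a point of `Ω_{n,h}`: variable
`m = v·2h + j` (`v < n`, `j < 2h`, the numbering of `xorBlock (2h) v` and of `finProdFinEquiv`) gets
coordinate `j` of block `v`; variables `≥ 2hn` are `false`. [cite: GargEtAl2020, §2 (blocks of F ∘ gⁿ)] -/
def blockAssignment {n h : ℕ} (y : IPOmega n h) : ℕ → Bool :=
  fun m => if hm : m < n * (2 * h) then
    (y (finProdFinEquiv.symm ⟨m, hm⟩).1).toBool (finProdFinEquiv.symm ⟨m, hm⟩).2 else false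

/-- The BASE assignment `z(y)` induced by a point of `Ω_{n,h}`: `z_v = IP_h(y_v)` for `v < n`, and
`false` on variables `≥ n` (base CNFs have `numVars ≤ n`); equals
`gadgetAssignment (2h) (ipGadget h) (blockAssignment y)` below `n`. [cite: BhattacharyaChattopadhyay2025, Def. 3.5 (semantics of Φ ∘ g)] -/
def ipAssignment {n h : ℕ} (y : IPOmega n h) : ℕ → Bool :=
  fun v => if hv : v < n then ipBit (y ⟨v, hv⟩) else false

/-! ### Block rank and deficiency closure of an affine subspace -/

variable {n h : ℕ}

/-- The coordinate projection of `Ω_{n,h}` onto the blocks in `S` (the other blocks are zeroed), as a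
linear endomorphism; its range has dimension `2h|S|`. [folklore] -/
def blockProj (S : Finset (Fin n)) : IPOmega n h →ₗ[ZMod 2] IPOmega n h where
  toFun y v := if v ∈ S then y v else 0
  map_add' y y' := by
    funext v
    by_cases hv : v ∈ S <;> simp [hv]
  map_smul' c y := by
    funext v
    by_cases hv : v ∈ S <;> simp [hv]

/-- The BLOCK RANK FUNCTION `ρ_A(S)` of an affine subspace `A ⊆ Ω_{n,h}`: the codimension of the
projection of `A` to the blocks `S` inside `(𝔽₂^{2h})^S`, i.e. `dim (rowspace(A) ∩ V_S)` for
`A = {y | My = e}` and `V_S` the forms supported on the blocks of `S`.  (`ℕ` subtraction never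
truncates: the image lies in the `2h|S|`-dimensional range of `blockProj S`.  For `A = ⊥` the direction
is `⊥` and `ρ_⊥(S) = 2h|S|`.) [cite: EfremenkoGarlikItsykson2024, §3 (support of linear forms on blocks; safe sets via ranks of block columns)] -/
def blockRank (A : AffineSubspace (ZMod 2) (IPOmega n h)) (S : Finset (Fin n)) : ℕ :=
  2 * h * S.card - Module.finrank (ZMod 2) ↥(A.direction.map (blockProj S))

/-- `T` is CLOSED for `A` at rate `θ`: every nonempty block-set `U` disjoint from `T` has rank
increment `ρ_A(T ∪ U) − ρ_A(T) ≤ θ|U| − 1` (written additively).  A `U` violating this is a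
*violator*. [cite: EfremenkoGarlikItsykson2024, §1.3.2 and Def. of closure in §4 (minimal dangerous sets = violators at rate 1)] -/
def IsBlockClosed (θ : ℕ) (A : AffineSubspace (ZMod 2) (IPOmega n h)) (T : Finset (Fin n)) : Prop :=
  ∀ U : Finset (Fin n), U.Nonempty → Disjoint U T →
    blockRank A (T ∪ U) + 1 ≤ blockRank A T + θ * U.card

/-- The DEFICIENCY CLOSURE `cl_θ(A)`: the intersection of all closed block-sets, which is the unique
inclusion-least closed set (closed sets are stable under intersection by supermodularity of `ρ_A`;
`univ` is closed). [cite: EfremenkoGarlikItsykson2024, Lemma 4.1 (uniqueness of the closure)] -/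
def blockClosure (θ : ℕ) (A : AffineSubspace (ZMod 2) (IPOmega n h)) : Finset (Fin n) :=
  univ.filter fun v => ∀ T : Finset (Fin n), IsBlockClosed θ A T → v ∈ T

/-- `A` is `D`-GOOD at rate `θ`: its closure has at most `D` blocks (otherwise BAD).
[cite: BhattacharyaChattopadhyay2025, §4 (nodes classified by the size of the closure of their affine space)] -/
def IsGoodLabel (θ D : ℕ) (A : AffineSubspace (ZMod 2) (IPOmega n h)) : Prop :=
  (blockClosure θ A).card ≤ D

/-- The affine hyperplane `{y | f y = b}` of a linear query. [folklore] -/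
def queryLevel (f : Module.Dual (ZMod 2) (IPOmega n h)) (b : ZMod 2) :
    AffineSubspace (ZMod 2) (IPOmega n h) where
  carrier := {y | f y = b}
  smul_vsub_vadd_mem' c p₁ p₂ p₃ h₁ h₂ h₃ := by
    simp only [Set.mem_setOf_eq, vsub_eq_sub, vadd_eq_add, map_add, map_smul, map_sub] at *
    rw [h₁, h₂, h₃]; simp

/-! ### Parity decision DAGs (affine DAGs) -/

/-- The shape of a node of a parity decision DAG with `N` nodes on `Ω_{n,h}`: a sink, a pass
(weakening) node with one child, or a decision node with a linear query and one child per answer.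
[cite: BhattacharyaChattopadhyay2025, Def. 3.2 (leaf / weakening node / query node)] -/
inductive DagNode (n h N : ℕ)
  /-- out-degree 0 -/
  | sink : DagNode n h N
  /-- out-degree 1: weakening -/
  | pass (child : Fin N) : DagNode n h N
  /-- out-degree 2: query the linear form `form`, child `child b` for the answer `b` -/
  | decide (form : Module.Dual (ZMod 2) (IPOmega n h)) (child : ZMod 2 → Fin N) : DagNode n h N

/-- The children of a node. [cite: BhattacharyaChattopadhyay2025, Def. 3.2] -/
def DagNode.children {N : ℕ} : DagNode n h N → Finset (Fin N)
  | .sink => ∅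
  | .pass c => {c}
  | .decide _ ch => {ch 0, ch 1}

/-- A PARITY DECISION DAG on `Ω_{n,h}` with node set `Fin N`: root labelled `⊤`; every node labelled by
an affine subspace (possibly `⊥`); on a pass edge `A_u ≤ A_w`; at a decision node the half
`A_u ∩ {f_u = b}` is contained in the label of `child b`, the two children are distinct and have no
other parent (decision out-edges do not merge — insert pass nodes to share); `rank` increases along
edges (acyclicity).  The SIZE is `N`. [cite: BhattacharyaChattopadhyay2025, Def. 3.2 (affine DAG; Res(⊕) refutations as affine DAGs)] -/
structure ParityDag (n h N : ℕ) where
  /-- the source -/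
  root : Fin N
  /-- the affine label `A_u` -/
  label : Fin N → AffineSubspace (ZMod 2) (IPOmega n h)
  /-- the node shape (sink / pass / decide) -/
  node : Fin N → DagNode n h N
  /-- a ranking certifying acyclicity -/
  rank : Fin N → ℕ
  root_label : label root = ⊤
  pass_le : ∀ u c, node u = .pass c → label u ≤ label c
  decide_half : ∀ u f ch, node u = .decide f ch → ∀ (b : ZMod 2), ∀ y ∈ label u, f y = b → y ∈ label (ch b)
  decide_distinct : ∀ u f ch, node u = .decide f ch → ch 0 ≠ ch 1
  decide_private : ∀ u f ch, node u = .decide f ch → ∀ (b : ZMod 2) (u' : Fin N), ch b ∈ (node u').children → u' = u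
  rank_lt : ∀ u, ∀ c ∈ (node u).children, rank u < rank c

namespace ParityDag

variable {N : ℕ}

/-- The children of node `u`. [cite: BhattacharyaChattopadhyay2025, Def. 3.2] -/
def children (G : ParityDag n h N) (u : Fin N) : Finset (Fin N) := (G.node u).children

/-- `G` REFUTES the base CNF `φ` through the gadget: every sink label is contained in the set of
points whose induced base assignment `z(y)` falsifies one fixed clause of `φ` (the lifted search
problem `Search(φ ∘ IP)`, BC25 Def. 3.2 third bullet, with the lift read semantically).
[cite: BhattacharyaChattopadhyay2025, Def. 3.2 and Def. 3.5 (semantic interpretation of Φ ∘ g)] -/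
def Refutes (G : ParityDag n h N) (φ : CNF ℕ) : Prop :=
  ∀ s, G.node s = .sink → ∃ c ∈ φ, ∀ y ∈ G.label s, Clause.eval (ipAssignment y) c = false

/-- The label of the π-edge `u → c`: `A_u ∩ {f_u = b}` on the decision edge towards `child b`
(side `0` if, degenerately, `c` is not a child), `A_u` on a pass edge, `⊥` at a sink. [folklore] -/
def edgeLabel (G : ParityDag n h N) (u c : Fin N) : AffineSubspace (ZMod 2) (IPOmega n h) :=
  match G.node u with
  | .sink => ⊥
  | .pass _ => G.label u
  | .decide f ch => G.label u ⊓ queryLevel f (if ch 1 = c then 1 else 0)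

/-- The BAD MASS `β(π) := Σ_{u bad} |A_u| / |Ω|` (each node once, whatever its in-degree; empty labels
contribute `0`). [folklore] -/
def badMass (G : ParityDag n h N) (θ D : ℕ) : ℝ :=
  (∑ u ∈ univ.filter (fun u => ¬ IsGoodLabel θ D (G.label u)), (Nat.card (G.label u) : ℝ)) /
    Nat.card (IPOmega n h)

end ParityDag

/-! ### Atserias–Dalmau families and oblivious demand rules -/

/-- `H` is an ATSERIAS–DALMAU FAMILY for `φ` below size `k` (records = finite sets of TRUE literals
of the base variables): `∅ ∈ H`, closed under sub-records, no record falsifies a clause of `φ`, and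
every record with fewer than `k` literals extends by either value of any variable.  These are the
four conclusions of `adGood_family`. [cite: AtseriasDalmau2008, Def. 2 and Thm. 2] -/
structure IsADFamily (φ : CNF ℕ) (k : ℕ) (H : Set (Finset (Literal ℕ))) : Prop where
  empty_mem : (∅ : Finset (Literal ℕ)) ∈ H
  subset_mem : ∀ ⦃α β : Finset (Literal ℕ)⦄, α ∈ H → β ⊆ α → β ∈ H
  not_falsifies : ∀ ⦃α : Finset (Literal ℕ)⦄, α ∈ H → ∀ c ∈ φ, ¬ Falsifies α c.toFinset
  extend : ∀ ⦃α : Finset (Literal ℕ)⦄, α ∈ H → α.card < k → ∀ x : ℕ, ∃ b : Bool, insert (x, b) α ∈ H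

/-- A RECORD of the game: a partial assignment of block coordinates (`some` exactly on the closed
blocks of the current label). [cite: BhattacharyaChattopadhyay2025, Def. 3.20 (closure assignment)] -/
abbrev ClosureRecord (n h : ℕ) : Type := Fin n → Option (IPBlock h)

/-- The restriction of a point to the blocks `K`, as a record. [cite: BhattacharyaChattopadhyay2025, Def. 3.20] -/
def recordOn (K : Finset (Fin n)) (y : IPOmega n h) : ClosureRecord n h :=
  fun v => if v ∈ K then some (y v) else none

/-- A POSITION `(u, α)`: a node together with a record. [cite: BhattacharyaChattopadhyay2025, §4 (pairs (v_j, y_j))] -/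
abbrev GamePosition (n h N : ℕ) : Type := Fin N × ClosureRecord n h

/-- The vertices of the POSITION DAG: positions, and terminals `(P, c)` = "from `P` the Mover entered
the bad child `c`" (the Trapper wins there). [folklore] -/
abbrev GameVertex (n h N : ℕ) : Type := GamePosition n h N ⊕ (GamePosition n h N × Fin N)

/-- The base record `z(α)`: the gadget values of the recorded blocks, as a set of true literals of the
base variables. [cite: BhattacharyaChattopadhyay2025, §4 (G(y) for a closure assignment y)] -/
def zRecord (α : ClosureRecord n h) : Finset (Literal ℕ) :=
  (univ.filter fun v : Fin n => (α v).isSome).image fun v : Fin n => (v.val, ((α v).map ipBit).getD false)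

/-- Extending a base record by the demanded bits `ζ` on the blocks `J`. [folklore] -/
def extendRecord (σ : Finset (Literal ℕ)) (J : Finset (Fin n)) (ζ : Fin n → Bool) : Finset (Literal ℕ) :=
  σ ∪ J.image fun v : Fin n => (v.val, ζ v)

/-- An OBLIVIOUS DEMAND RULE (Trapper) `δ(record, J)` is LEGAL for `H` if its demand keeps the extended
record in `H` whenever some demand does. [cite: AtseriasDalmau2008, Thm. 2 (Duplicator strategy from the family)] -/
def IsLegalTrapper (H : Set (Finset (Literal ℕ)))
    (δ : Finset (Literal ℕ) → Finset (Fin n) → (Fin n → Bool)) : Prop :=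
  ∀ σ J, (∃ ζ : Fin n → Bool, extendRecord σ J ζ ∈ H) → extendRecord σ J (δ σ J) ∈ H

/-- Legal demand rules exist (choose any admissible demand). [folklore] -/
theorem exists_isLegalTrapper (H : Set (Finset (Literal ℕ))) :
    ∃ δ : Finset (Literal ℕ) → Finset (Fin n) → (Fin n → Bool), IsLegalTrapper H δ := by
  refine ⟨fun σ J => if hx : ∃ ζ : Fin n → Bool, extendRecord σ J ζ ∈ H then hx.choose
    else fun _ => false, fun σ J hx => ?_⟩
  simp only [dif_pos hx]
  exact hx.choose_spec

/-! ### The closure piece game and its position DAG -/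

namespace ParityDag

variable {N : ℕ}

/-- The PIECE `Q_{(u,α)} := A_u ∩ {y | y_v = α_v on the recorded blocks}` (= BC25's `A_y`).
[cite: BhattacharyaChattopadhyay2025, Def. 3.20 and §3.5 (A_y)] -/
def piece (G : ParityDag n h N) (P : GamePosition n h N) : Set (IPOmega n h) :=
  {y | y ∈ G.label P.1 ∧ ∀ v b, P.2 v = some b → y v = b}

/-- A VALID position at rate `θ`, budget `D`: `u` is good, the record lives exactly on `cl_θ(A_u)`,
and the piece is nonempty. [folklore] -/
def IsPosition (G : ParityDag n h N) (θ D : ℕ) (P : GamePosition n h N) : Prop :=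
  IsGoodLabel θ D (G.label P.1) ∧ (∀ v, (P.2 v).isSome ↔ v ∈ blockClosure θ (G.label P.1)) ∧
    (piece G P).Nonempty

/-- The NEWLY CLOSED BLOCKS at `u`: `J_u := (⋃_{good children c} cl(A_c)) ∖ cl(A_u)`, `|J_u| ≤ 2D`.
[folklore] -/
def newlyClosed (G : ParityDag n h N) (θ D : ℕ) (u : Fin N) : Finset (Fin n) :=
  (((G.children u).filter fun c => IsGoodLabel θ D (G.label c)).biUnion
      fun c => blockClosure θ (G.label c)) \ blockClosure θ (G.label u)

/-- The CLASS `Q_{P,ζ}` of the piece demanded by the rule `δ`: the points of the piece whose gadget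
values on the newly closed blocks are `ζ = δ(z(α), J_u)`. [folklore] -/
def demandedClass (G : ParityDag n h N) (θ D : ℕ)
    (δ : Finset (Literal ℕ) → Finset (Fin n) → (Fin n → Bool)) (P : GamePosition n h N) :
    Set (IPOmega n h) :=
  {y | y ∈ piece G P ∧ ∀ v ∈ newlyClosed G θ D P.1, ipBit (y v) = δ (zRecord P.2) (newlyClosed G θ D P.1) v}

/-- The root vertex `(r, ∅)`. [folklore] -/
def rootVertex (G : ParityDag n h N) : GameVertex n h N := Sum.inl (G.root, fun _ => none)

/-- The MOVES of the closure piece game against the demand rule `δ`: from a valid position `P = (u, α)`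
the Mover names `y* ∈ Q_{P,δ}` and a child `c` with `y* ∈ A_c`; if `c` is good the play continues at
`(c, y*|_{cl(A_c)})`, if `c` is bad it ends at the terminal `(P, c)`. [folklore] -/
def Adj (G : ParityDag n h N) (θ D : ℕ)
    (δ : Finset (Literal ℕ) → Finset (Fin n) → (Fin n → Bool)) : GameVertex n h N → GameVertex n h N → Prop
  | .inl P, .inl P' => IsPosition G θ D P ∧ P'.1 ∈ G.children P.1 ∧ IsGoodLabel θ D (G.label P'.1) ∧
      ∃ y ∈ demandedClass G θ D δ P, y ∈ G.label P'.1 ∧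
        P'.2 = recordOn (blockClosure θ (G.label P'.1)) y
  | .inl P, .inr (P', c) => P' = P ∧ IsPosition G θ D P ∧ c ∈ G.children P.1 ∧
      ¬ IsGoodLabel θ D (G.label c) ∧ ∃ y ∈ demandedClass G θ D δ P, y ∈ G.label c
  | .inr _, _ => False

/-- ROOT PATHS of the position DAG: nonempty vertex lists starting at the root and chained by moves.
[folklore] -/
def IsRootPath (G : ParityDag n h N) (θ D : ℕ)
    (δ : Finset (Literal ℕ) → Finset (Fin n) → (Fin n → Bool)) (l : List (GameVertex n h N)) : Prop :=
  l.head? = some (rootVertex G) ∧ l.IsChain (Adj G θ D δ)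

/-- A BLOCKING SET: a set of vertices meeting every maximal root path. [folklore] -/
def IsBlocking (G : ParityDag n h N) (θ D : ℕ)
    (δ : Finset (Literal ℕ) → Finset (Fin n) → (Fin n → Bool)) (X : Finset (GameVertex n h N)) : Prop :=
  ∀ l, IsRootPath G θ D δ l → (∀ v, l.getLast? = some v → ∀ w, ¬ Adj G θ D δ v w) → ∃ x ∈ X, x ∈ l

/-- The closure-corrected PIECE MASS: `Φ(u, α) := 2^{|cl(A_u)|} · |Q_{(u,α)}|` at a position, and
`2^{|cl(A_u)|} · |Q_{P,δ} ∩ A_c|` at the terminal `(P, c)`. [folklore] -/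
def pieceMass (G : ParityDag n h N) (θ D : ℕ)
    (δ : Finset (Literal ℕ) → Finset (Fin n) → (Fin n → Bool)) : GameVertex n h N → ℕ
  | .inl P => 2 ^ (blockClosure θ (G.label P.1)).card * Nat.card (piece G P)
  | .inr (P, c) => 2 ^ (blockClosure θ (G.label P.1)).card *
      Nat.card {y // y ∈ demandedClass G θ D δ P ∧ y ∈ G.label c}

/-- The EDGE COUPLING `ι(u → c) := codim B − ρ_B(K ∪ J) − ρ_B(K ∪ R) + ρ_B(K)` of a π-edge, with
`B` the edge label, `K = cl(A_u)`, `J = cl(A_c) ∖ K`, `R` the remaining blocks: the conditional mutual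
information `I_B(J : R | K)` of the uniform law on `B`; `ℕ`-valued (the integer is `≥ 0` by
supermodularity of `ρ_B`). [folklore] -/
def iota (G : ParityDag n h N) (θ : ℕ) (u c : Fin N) : ℕ :=
  let B := G.edgeLabel u c
  let K := blockClosure θ (G.label u)
  let K' := blockClosure θ (G.label c)
  (Module.finrank (ZMod 2) (IPOmega n h) - Module.finrank (ZMod 2) ↥B.direction) + blockRank B K -
    blockRank B (K ∪ K') - blockRank B (K ∪ (K ∪ K')ᶜ)

/-- The coupling carried by a move: `ι` of the underlying π-edge between positions, `0` into terminals.
[folklore] -/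
def edgeIota (G : ParityDag n h N) (θ : ℕ) : GameVertex n h N → GameVertex n h N → ℕ
  | .inl P, .inl P' => iota G θ P.1 P'.1
  | _, _ => 0

/-- The COUPLING BUDGET spent along a vertex list: the sum of `edgeIota` over consecutive pairs
(`ῑ(x)` is its maximum over root paths ending at `x`). [folklore] -/
def pathIota (G : ParityDag n h N) (θ : ℕ) : List (GameVertex n h N) → ℕ
  | v :: w :: rest => edgeIota G θ v w + pathIota G θ (w :: rest)
  | _ => 0

/-- The MIN-CUT FLOOR predicate: every blocking set has `Φ`-mass at least `ε |Ω|`. [folklore] -/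
def HasCutFloor (G : ParityDag n h N) (θ D : ℕ)
    (δ : Finset (Literal ℕ) → Finset (Fin n) → (Fin n → Bool)) (ε : ℝ) : Prop :=
  ∀ X : Finset (GameVertex n h N), IsBlocking G θ D δ X →
    ε * Nat.card (IPOmega n h) ≤ ∑ x ∈ X, (pieceMass G θ D δ x : ℝ)

end ParityDag

end

end Literature.Computability.MetaComplexity
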